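import Literature.MathematicalPhysics.QuantumLattice.HubbardStateSectorDecomposition
import Literature.MathematicalPhysics.QuantumLattice.HubbardModelParticleHoleProofs
import Literature.MathematicalPhysics.QuantumLattice.HubbardChainSegmentUpperBound
import Literature.LinearAlgebra.Matrix.PosSemidefTrace
import HarnessLib

/-!
# Grand-canonical (arbitrary particle number, mixed) trial states bound the half-filled Hubbard
# chain from above: `E_{path 2n}(2n) ≤ 2 Re Tr(ρ H_{path n}) + U (n − Re Tr(ρ N̂))`

Family `hubbard` (trunk T-QLATTICE); continues `HubbardChainSegmentUpperBound` (open segments bound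
the ring limit, cuts of an open chain are free), `HubbardStateSectorDecomposition` (the Hubbard
Hamiltonian dominates `Σ_N E_G(N) P_N`) and `HubbardModelParticleHoleProofs` (bipartite particle–hole
symmetry of the sector energies). The variational upper bounds of the tree for the half-filled chain
energy density `e(t,U) = hubbardChainEnergyDensity t U` take trial VECTORS of FIXED particle number
`a` on an open segment of `a` sites (`hubbardChainEnergyDensity_le_re_expect_segment`). Trial states
produced by transfer-operator / matrix-product constructions are neither pure nor of fixed particle
number: they are density matrices `ρ` on the full Fock space of the segment. This file proves the
bound such states give, with NO sector hypothesis on `ρ`: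

* `sum_re_trace_mul_numberProj_mul_groundEnergyAt_le` — for every graph `G` on a finite ordered site
  set and every positive semidefinite `ρ` on its Fock space,
  `Σ_N Re Tr(ρ P_N) · E_G(N) ≤ Re Tr(ρ H_G)` (the density-matrix form of the tree's
  `posSemidef_hamiltonian_sub_sum_groundEnergyAt_smul_numberProj`; Ruelle (1969) §2.4), with the
  number distribution `p_N = Re Tr(ρ P_N) ≥ 0`, `Σ_N p_N = Re Tr ρ`, `Σ_N N p_N = Re Tr(ρ N̂)`
  (`re_trace_mul_numberProj_nonneg`, `sum_range_re_trace_mul_numberProj`,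
  `sum_range_mul_re_trace_mul_numberProj`).
* `groundEnergyAt_pathGraph_particleHole` — the path graph is bipartite (sign `(-1)^j`), so
  `E_{path n}(N) = E_{path n}(2n − N) − (n − N) U` (Lieb–Wu (2003) eq. (3), the tree's
  `groundEnergyAt_particleHole`).
* `groundEnergyAt_pathGraph_double_le` — **doubling**: `E_{path 2n}(2n) ≤ 2 E_{path n}(k) + (n − k) U`
  for every `k ≤ 2n`: cut the half-filled chain of `2n` sites into two segments carrying `k` and
  `2n − k` particles (free, `groundEnergyAt_pathGraph_add_le`) and apply particle–hole symmetry to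
  the second. Equivalently `E_{path 2n}(2n) − (U/2)·2n ≤ 2 (E_{path n}(k) − (U/2) k)`: at half filling
  the chemical potential is `U/2` (Lieb–Wu: `μ₊ + μ₋ = U`), and the grand-canonical energies at
  `μ = U/2` of the two halves add up.
* `groundEnergyAt_pathGraph_double_le_re_trace` — averaging the doubling inequality over the number
  distribution of a density matrix `ρ` (`ρ ⪰ 0`, `Tr ρ = 1`) on the `n`-site segment:
  `E_{path 2n}(2n) ≤ 2 Re Tr(ρ H_{path n}) + U (n − Re Tr(ρ N̂))`.
* `hubbardChainEnergyDensity_le_re_trace_grandCanonical_segment` — the thermodynamic-limit form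
  (`U ≥ 0`, `n ≥ 1`): `e(t,U) ≤ (Re Tr(ρ H_{path n}) + (U/2)(n − Re Tr(ρ N̂))) / n`, i.e. the
  half-filled energy density is below the `μ = U/2` grand-canonical energy density (shifted back by
  `U/2`) of ANY mixed state of ANY open segment; `…_le_re_expect_grandCanonical_segment` is the pure
  case (a unit vector of arbitrary particle content).

Everything is PROVED from the tree; no definition, no named fact. (The bound with `ρ` the reduced
state of a uniform matrix-product state is the soundness half of transfer-matrix upper-bound
certificates for `e(t,U)`; how `ρ` was obtained is irrelevant to the inequality.)

## References
* D. Ruelle, *Statistical Mechanics: Rigorous Results* (1969), §2.2 (boxes bound the limit; free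
  cuts) and §2.4 (variational principle in finite volume). [cite: Ruelle1969, §2.2, §2.4]
* E. H. Lieb, F. Y. Wu, Physica A 321 (2003) 1, §1 eq. (3) (particle–hole symmetry
  `E(M,M') = −(N_a − N)U + E(N_a − M, N_a − M')`) and §7 (`μ₊ + μ₋ = U` at half filling).
  [cite: LiebWuPhysicaA2003, §1 eq. (3), §7]
* H. Tasaki, *Physics and Mathematics of Quantum Many-Body Systems* (2020), §2.1 (variational
  characterisation of the ground-state energy, mixed states). [cite: Tasaki2020, §2.1]
-/

noncomputable section

open Matrix Finset Filter Topology
open scoped ComplexOrder BigOperators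

namespace Literature.MathematicalPhysics.QuantumLattice

open HubbardWave0 Literature.Probability.LatticeModels Literature.LinearAlgebra.Matrix

/-! ### The number distribution of a density matrix and the sector energy bound -/

section DensityMatrix

variable {ι : Type*} [Fintype ι] [DecidableEq ι]

/-- The sector projection `P_N` (a diagonal 0/1 matrix) is positive semidefinite. [folklore]
[cite: Ruelle1969, §2.4] -/
theorem posSemidef_numberProj (N : ℕ) :
    (numberProj N : Matrix (Finset ι) (Finset ι) ℂ).PosSemidef := by
  have h : (numberProj N : Matrix (Finset ι) (Finset ι) ℂ) = (numberProj N)ᴴ * numberProj N := by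
    rw [(numberProj_isHermitian N).eq, numberProj, diagonal_mul_diagonal]
    congr 1
    funext s
    split_ifs <;> simp
  rw [h]
  exact Matrix.posSemidef_conjTranspose_mul_self _

/-- The number distribution of a positive semidefinite `ρ` is nonnegative: `Re Tr(ρ P_N) ≥ 0`.
[folklore] [cite: Ruelle1969, §2.4] -/
theorem re_trace_mul_numberProj_nonneg {ρ : Matrix (Finset ι) (Finset ι) ℂ} (hρ : ρ.PosSemidef)
    (N : ℕ) : 0 ≤ (ρ * (numberProj N : Matrix (Finset ι) (Finset ι) ℂ)).trace.re :=
  re_trace_mul_nonneg_of_posSemidef hρ (posSemidef_numberProj N)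

/-- The number distribution resolves the trace: `Σ_{N ≤ |ι|} Re Tr(ρ P_N) = Re Tr ρ`. [folklore]
[cite: Ruelle1969, §2.4] -/
theorem sum_range_re_trace_mul_numberProj (ρ : Matrix (Finset ι) (Finset ι) ℂ) :
    ∑ N ∈ range (Fintype.card ι + 1),
        (ρ * (numberProj N : Matrix (Finset ι) (Finset ι) ℂ)).trace.re = ρ.trace.re := by
  rw [← Complex.re_sum, ← trace_sum, ← Finset.mul_sum, sum_range_numberProj, Matrix.mul_one]

variable {Λ : Type*} [LinearOrder Λ] [Fintype Λ]

/-- The mean of the number distribution is the expected particle number: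
`Σ_{N ≤ 2|Λ|} N · Re Tr(ρ P_N) = Re Tr(ρ N̂)`. [folklore] [cite: Ruelle1969, §2.4] -/
theorem sum_range_mul_re_trace_mul_numberProj (ρ : Matrix (Finset (Orb Λ)) (Finset (Orb Λ)) ℂ) :
    ∑ N ∈ range (Fintype.card (Orb Λ) + 1),
        (N : ℝ) * (ρ * (numberProj N : Matrix (Finset (Orb Λ)) (Finset (Orb Λ)) ℂ)).trace.re =
      (ρ * totalNumber).trace.re := by
  rw [← sum_range_smul_numberProj_eq_totalNumber, Finset.mul_sum, trace_sum, Complex.re_sum]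
  refine Finset.sum_congr rfl fun N _ => ?_
  rw [Matrix.mul_smul, trace_smul, smul_eq_mul, show ((N : ℂ)) = ((N : ℝ) : ℂ) by norm_cast,
    Complex.re_ofReal_mul]

/-- **The energy of a density matrix is at least its number distribution's worth of sector ground
energies**: for every graph `G` on a finite ordered site set, all real `t, U` and every positive
semidefinite `ρ` on the Fock space, `Σ_{N ≤ 2|Λ|} Re Tr(ρ P_N) · E_G(N) ≤ Re Tr(ρ H_G)` (positivity of
`Re Tr(ρ ·)` on the positive semidefinite `H_G − Σ_N E_G(N) P_N`). Ruelle (1969) §2.4; Tasaki (2020)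
§2.1. [cite: Ruelle1969, §2.4] [cite: Tasaki2020, §2.1] -/
theorem sum_re_trace_mul_numberProj_mul_groundEnergyAt_le (G : SimpleGraph Λ) [DecidableRel G.Adj]
    (t U : ℝ) {ρ : Matrix (Finset (Orb Λ)) (Finset (Orb Λ)) ℂ} (hρ : ρ.PosSemidef) :
    ∑ N ∈ range (Fintype.card (Orb Λ) + 1),
        (ρ * (numberProj N : Matrix (Finset (Orb Λ)) (Finset (Orb Λ)) ℂ)).trace.re *
          groundEnergyAt G t U N ≤
      (ρ * hamiltonian G t U).trace.re := by
  have h := re_trace_mul_nonneg_of_posSemidef hρ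
    (posSemidef_hamiltonian_sub_sum_groundEnergyAt_smul_numberProj G t U)
  rw [Matrix.mul_sub, trace_sub, Complex.sub_re, Finset.mul_sum, trace_sum, Complex.re_sum,
    sub_nonneg] at h
  refine le_of_eq_of_le ?_ h
  refine Finset.sum_congr rfl fun N _ => ?_
  rw [Matrix.mul_smul, trace_smul, smul_eq_mul, Complex.re_ofReal_mul, mul_comm]

omit [DecidableEq ι] in
/-- The rank-one density matrix of a vector reproduces expectations:
`Tr(|ψ⟩⟨ψ| A) = ⟨ψ, A ψ⟩`. [folklore] [cite: Tasaki2020, §2.1] -/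
theorem trace_vecMulVec_star_mul_eq_dotProduct_mulVec (ψ : Finset ι → ℂ)
    (A : Matrix (Finset ι) (Finset ι) ℂ) :
    (vecMulVec ψ (star ψ) * A).trace = star ψ ⬝ᵥ (A *ᵥ ψ) := by
  rw [vecMulVec_mul, trace_vecMulVec, dotProduct_comm, ← dotProduct_mulVec]

end DensityMatrix

namespace ThermodynamicLimit

/-! ### Particle–hole symmetry on the open chain and the doubling inequality -/

/-- The open chain is bipartite: the sign `j ↦ (-1)^j` (`+1` on even, `-1` on odd sites) alternates
along every bond of `SimpleGraph.pathGraph n`. [folklore] [cite: LiebWuPhysicaA2003, §1 eq. (3)] -/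
theorem pathGraph_sign_adj (n : ℕ) :
    ∀ x y : Fin n, (SimpleGraph.pathGraph n).Adj x y →
      (fun j : Fin n => if Even (j : ℕ) then (1 : ℤˣ) else -1) x =
        -(fun j : Fin n => if Even (j : ℕ) then (1 : ℤˣ) else -1) y := by
  intro x y h
  rw [SimpleGraph.pathGraph_adj] at h
  simp only
  rcases h with h | h
  · rw [← h]
    by_cases hx : Even (x : ℕ) <;> simp [hx, Nat.even_add_one]
  · rw [← h]
    by_cases hy : Even (y : ℕ) <;> simp [hy, Nat.even_add_one]

/-- **Particle–hole symmetry of the open-chain sector energies**: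
`E_{path n}(N) = E_{path n}(2n − N) − (n − N) U` for `N ≤ 2n` and all real `t, U` (the tree's
`groundEnergyAt_particleHole` with the bipartite sign `(-1)^j`). Lieb–Wu (2003) §1 eq. (3).
[cite: LiebWuPhysicaA2003, §1 eq. (3)] -/
theorem groundEnergyAt_pathGraph_particleHole (n : ℕ) (t U : ℝ) {N : ℕ} (hN : N ≤ 2 * n) :
    groundEnergyAt (SimpleGraph.pathGraph n) t U N =
      groundEnergyAt (SimpleGraph.pathGraph n) t U (2 * n - N) - ((n : ℝ) - N) * U := by
  have h := groundEnergyAt_particleHole (SimpleGraph.pathGraph n)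
    (fun j : Fin n => if Even (j : ℕ) then (1 : ℤˣ) else -1) (pathGraph_sign_adj n) t U (N := N)
    (by rwa [Fintype.card_fin])
  simpa only [Fintype.card_fin] using h

/-- **Doubling inequality**: `E_{path 2n}(2n) ≤ 2 E_{path n}(k) + (n − k) U` for every `k ≤ 2n` and
all real `t, U`: cut the half-filled open chain of `2n` sites into two open segments of `n` sites
carrying `k` and `2n − k` particles (`groundEnergyAt_pathGraph_add_le`, no defect) and rewrite
`E_{path n}(2n − k) = E_{path n}(k) + (n − k) U` (`groundEnergyAt_pathGraph_particleHole`). In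
grand-canonical form, `E_{path 2n}(2n) − (U/2)(2n) ≤ 2 (E_{path n}(k) − (U/2) k)`: the chemical
potential of the half-filled chain is `U/2` (Lieb–Wu, `μ₊ + μ₋ = U`). Ruelle (1969) §2.2; Lieb–Wu
(2003) §1 eq. (3), §7. [cite: Ruelle1969, §2.2] [cite: LiebWuPhysicaA2003, §1 eq. (3), §7] -/
theorem groundEnergyAt_pathGraph_double_le (n : ℕ) (t U : ℝ) {k : ℕ} (hk : k ≤ 2 * n) :
    groundEnergyAt (SimpleGraph.pathGraph (n + n)) t U (n + n) ≤
      2 * groundEnergyAt (SimpleGraph.pathGraph n) t U k + ((n : ℝ) - k) * U := by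
  have hcut := groundEnergyAt_pathGraph_add_le n n t U (N₁ := k) (N₂ := 2 * n - k) hk (by omega)
  have hsum : k + (2 * n - k) = n + n := by omega
  rw [hsum] at hcut
  have hph := groundEnergyAt_pathGraph_particleHole n t U hk
  linarith

/-- **Grand-canonical mixed trial states bound the half-filled doubled chain**: for every density
matrix `ρ` (`ρ ⪰ 0`, `Tr ρ = 1`) on the Fock space of the open chain of `n` sites — no particle-number
or purity hypothesis — and all real `t, U`,
`E_{path 2n}(2n) ≤ 2 Re Tr(ρ H_{path n}) + U (n − Re Tr(ρ N̂))`.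
Proof: average the doubling inequality `E_{path 2n}(2n) ≤ 2 E_{path n}(k) + (n − k) U` over the
number distribution `p_k = Re Tr(ρ P_k)` (`p_k ≥ 0`, `Σ p_k = 1`, `Σ k p_k = Re Tr(ρ N̂)`) and use
`Σ_k p_k E_{path n}(k) ≤ Re Tr(ρ H_{path n})`. Ruelle (1969) §2.2, §2.4; Lieb–Wu (2003) §1 eq. (3);
Tasaki (2020) §2.1. [cite: Ruelle1969, §2.2, §2.4] [cite: LiebWuPhysicaA2003, §1 eq. (3), §7]
[cite: Tasaki2020, §2.1] -/
theorem groundEnergyAt_pathGraph_double_le_re_trace (n : ℕ) (t U : ℝ)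
    {ρ : Matrix (Finset (Orb (Fin n))) (Finset (Orb (Fin n))) ℂ} (hρ : ρ.PosSemidef)
    (htr : ρ.trace = 1) :
    groundEnergyAt (SimpleGraph.pathGraph (n + n)) t U (n + n) ≤
      2 * (ρ * hamiltonian (SimpleGraph.pathGraph n) t U).trace.re +
        U * ((n : ℝ) - (ρ * totalNumber).trace.re) := by
  set R : Finset ℕ := range (Fintype.card (Orb (Fin n)) + 1) with hR
  set p : ℕ → ℝ := fun N =>
    (ρ * (numberProj N : Matrix (Finset (Orb (Fin n))) (Finset (Orb (Fin n))) ℂ)).trace.re with hp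
  have hp0 : ∀ N, 0 ≤ p N := fun N => re_trace_mul_numberProj_nonneg hρ N
  have hp1 : ∑ N ∈ R, p N = 1 := by
    rw [hp, hR, sum_range_re_trace_mul_numberProj, htr, Complex.one_re]
  have hpN : ∑ N ∈ R, (N : ℝ) * p N = (ρ * totalNumber).trace.re :=
    sum_range_mul_re_trace_mul_numberProj ρ
  have hpE : ∑ N ∈ R, p N * groundEnergyAt (SimpleGraph.pathGraph n) t U N ≤
      (ρ * hamiltonian (SimpleGraph.pathGraph n) t U).trace.re :=
    sum_re_trace_mul_numberProj_mul_groundEnergyAt_le (SimpleGraph.pathGraph n) t U hρ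
  have hcard : Fintype.card (Orb (Fin n)) = 2 * n := by rw [card_orb, Fintype.card_fin]
  -- the doubling inequality, sector by sector, weighted by `p N ≥ 0`
  have hterm : ∀ N ∈ R, p N * groundEnergyAt (SimpleGraph.pathGraph (n + n)) t U (n + n) ≤
      p N * (2 * groundEnergyAt (SimpleGraph.pathGraph n) t U N + ((n : ℝ) - N) * U) := by
    intro N hN
    have hNle : N ≤ 2 * n := by
      rw [hR, mem_range, hcard] at hN
      omega
    exact mul_le_mul_of_nonneg_left (groundEnergyAt_pathGraph_double_le n t U hNle) (hp0 N)
  have hsum := Finset.sum_le_sum hterm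
  rw [← Finset.sum_mul, hp1, one_mul] at hsum
  have hrhs : ∑ N ∈ R, p N * (2 * groundEnergyAt (SimpleGraph.pathGraph n) t U N + ((n : ℝ) - N) * U) =
      2 * ∑ N ∈ R, p N * groundEnergyAt (SimpleGraph.pathGraph n) t U N +
        U * ((n : ℝ) * ∑ N ∈ R, p N - ∑ N ∈ R, (N : ℝ) * p N) := by
    rw [Finset.mul_sum, Finset.mul_sum, ← Finset.sum_sub_distrib, Finset.mul_sum,
      ← Finset.sum_add_distrib]
    refine Finset.sum_congr rfl fun N _ => ?_
    ring
  rw [hrhs, hp1, mul_one, hpN] at hsum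
  linarith

/-- The pure case: for every unit vector `ψ` of the `n`-site open chain (arbitrary particle content),
`E_{path 2n}(2n) ≤ 2 Re⟨ψ, H_{path n} ψ⟩ + U (n − Re⟨ψ, N̂ ψ⟩)`. Ruelle (1969) §2.2, §2.4; Lieb–Wu
(2003) §1 eq. (3); Tasaki (2020) §2.1. [cite: Ruelle1969, §2.2, §2.4]
[cite: LiebWuPhysicaA2003, §1 eq. (3), §7] [cite: Tasaki2020, §2.1] -/
theorem groundEnergyAt_pathGraph_double_le_re_expect (n : ℕ) (t U : ℝ) (ψ : Fock (Orb (Fin n)))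
    (hψ1 : star ψ ⬝ᵥ ψ = 1) :
    groundEnergyAt (SimpleGraph.pathGraph (n + n)) t U (n + n) ≤
      2 * (star ψ ⬝ᵥ (hamiltonian (SimpleGraph.pathGraph n) t U *ᵥ ψ)).re +
        U * ((n : ℝ) - (star ψ ⬝ᵥ (totalNumber *ᵥ ψ)).re) := by
  have h := groundEnergyAt_pathGraph_double_le_re_trace n t U (posSemidef_vecMulVec_self_star ψ)
    (by rw [trace_vecMulVec, dotProduct_comm, hψ1])
  rwa [trace_vecMulVec_star_mul_eq_dotProduct_mulVec,
    trace_vecMulVec_star_mul_eq_dotProduct_mulVec] at h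

/-! ### Thermodynamic limit -/

/-- **Thermodynamic limit, grand-canonical mixed segment states**: for `U ≥ 0`, `n ≥ 1` and every
density matrix `ρ` (`ρ ⪰ 0`, `Tr ρ = 1`) on the Fock space of the open chain of `n` sites,
`e(t,U) ≤ (Re Tr(ρ H_{path n}) + (U/2)(n − Re Tr(ρ N̂))) / n`, where
`e = hubbardChainEnergyDensity t U` is the half-filled ring limit: combine
`e ≤ E_{path 2n}(2n)/(2n)` (`hubbardChainEnergyDensity_le_segment`) with
`groundEnergyAt_pathGraph_double_le_re_trace`. The half-filled energy density lies below the
`μ = U/2` grand-canonical energy density (plus `U/2`) of any state of any open segment.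
Ruelle (1969) §2.2, §2.4; Lieb–Wu (2003) §1 eq. (3), §7; Tasaki (2020) §2.1.
[cite: Ruelle1969, §2.2, §2.4] [cite: LiebWuPhysicaA2003, §1 eq. (3), §7] [cite: Tasaki2020, §2.1] -/
theorem hubbardChainEnergyDensity_le_re_trace_grandCanonical_segment (t : ℝ) {U : ℝ} (hU : 0 ≤ U)
    {n : ℕ} (hn : 1 ≤ n) {ρ : Matrix (Finset (Orb (Fin n))) (Finset (Orb (Fin n))) ℂ}
    (hρ : ρ.PosSemidef) (htr : ρ.trace = 1) :
    hubbardChainEnergyDensity t U ≤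
      ((ρ * hamiltonian (SimpleGraph.pathGraph n) t U).trace.re +
          U / 2 * ((n : ℝ) - (ρ * totalNumber).trace.re)) / n := by
  have hseg := hubbardChainEnergyDensity_le_segment t hU (a := n + n) (by omega)
  have hd := groundEnergyAt_pathGraph_double_le_re_trace n t U hρ htr
  have hnR : (0 : ℝ) < n := by exact_mod_cast hn
  have hcast : ((n + n : ℕ) : ℝ) = 2 * n := by push_cast; ring
  rw [hcast] at hseg
  have key := hseg.trans (div_le_div_of_nonneg_right hd (by positivity : (0 : ℝ) ≤ 2 * n))
  refine key.trans_eq ?_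
  rw [div_eq_div_iff (by positivity) hnR.ne']
  ring

/-- **Thermodynamic limit, grand-canonical pure segment states**: for `U ≥ 0`, `n ≥ 1` and every
unit vector `ψ` of the `n`-site open chain (arbitrary particle content),
`e(t,U) ≤ (Re⟨ψ, H_{path n} ψ⟩ + (U/2)(n − Re⟨ψ, N̂ ψ⟩)) / n`. Ruelle (1969) §2.2, §2.4; Lieb–Wu
(2003) §1 eq. (3), §7; Tasaki (2020) §2.1. [cite: Ruelle1969, §2.2, §2.4]
[cite: LiebWuPhysicaA2003, §1 eq. (3), §7] [cite: Tasaki2020, §2.1] -/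
theorem hubbardChainEnergyDensity_le_re_expect_grandCanonical_segment (t : ℝ) {U : ℝ} (hU : 0 ≤ U)
    {n : ℕ} (hn : 1 ≤ n) (ψ : Fock (Orb (Fin n))) (hψ1 : star ψ ⬝ᵥ ψ = 1) :
    hubbardChainEnergyDensity t U ≤
      ((star ψ ⬝ᵥ (hamiltonian (SimpleGraph.pathGraph n) t U *ᵥ ψ)).re +
          U / 2 * ((n : ℝ) - (star ψ ⬝ᵥ (totalNumber *ᵥ ψ)).re)) / n := by
  have h := hubbardChainEnergyDensity_le_re_trace_grandCanonical_segment t hU hn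
    (posSemidef_vecMulVec_self_star ψ) (by rw [trace_vecMulVec, dotProduct_comm, hψ1])
  rwa [trace_vecMulVec_star_mul_eq_dotProduct_mulVec,
    trace_vecMulVec_star_mul_eq_dotProduct_mulVec] at h

end ThermodynamicLimit

end Literature.MathematicalPhysics.QuantumLattice

end
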